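import Summits.HodgeConjecture.HodgeConjecture.Theorems.HeckePrymWeilWeilTwelvefoldsSqrtMinus7CmChartAlgebra
import Literature.NumberTheory.EllipticCurves.AbelianVarietyBridgeFullProofs
import Literature.NumberTheory.EllipticCurves.ComplexTorusAddProofs
import Literature.NumberTheory.EllipticCurves.ComplexTorusAnalytification
import Literature.NumberTheory.EllipticCurves.WeierstrassAddHomPoints
import Literature.NumberTheory.EllipticCurves.LatticeTransformationIdentity
import Literature.NumberTheory.EllipticCurves.CMEndomorphismOfCertificate
import Literature.NumberTheory.EllipticCurves.DivisionPolynomialTorsion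
import Literature.AlgebraicGeometry.Motives.AbelianVarietyRationalMaps
import Literature.AlgebraicGeometry.Motives.AbelianVarietyRigidity
import Literature.AlgebraicGeometry.Motives.AlgPointsSeparate
import HarnessLib

/-!
# Complex multiplication as an endomorphism of the abelian variety `E_Λ`

Crux `WeilTwelvefoldsSqrtMinus7` (stmt-HodgeConjecture-1261), line `amnesic-secant-sheaves-split-fourteenfolds`,
registered sub-goal of stub T_A1 `stub_cmCurveAction` (lead seat c1). For a period pair `L` (curve
`E_Λ : y² = x³ − (g₂/4)x − g₃/4` as a `ℂ`-group scheme, `WeierstrassCurve.abelianVarietyOfAddHom`), a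
multiplier `w ≠ 0` and transformation polynomials `P, Q ∈ ℂ[X]` (`Q ≠ 0`, `deg Q < deg P`) satisfying the
transformation identities `(H1)`, `(H2)` of `LatticeEndomorphism`/`LatticeTransformationIdentity`
(`℘(wz) = (P/Q)(℘ z)`, `℘'(wz) = w⁻¹(P/Q)'(℘ z)℘'(z)`; Cox, *Primes of the form x² + ny²*, Prop. 14.9),
**there is an ENDOMORPHISM `φ` of the abelian variety `E_Λ` (a homomorphism of `ℂ`-group schemes) acting
on complex points as `π(z) ↦ π(wz)`** (`exists_endomorphism_of_transformation`, def-free).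

Proof: the chart algebra map `θ : ℂ[E_Λ] → ℂ[E_Λ][1/Q]` of `HeckePrymWeilWeilTwelvefoldsSqrtMinus7CmChartAlgebra`
is `Spec`'d to a `ℂ`-morphism `D(Q) → E_Λ` on the non-empty open `D(Q) ⊂ Spec ℂ[E_Λ] ⊂ E_Λ`
(`Spec` of a localisation and the affine chart are open immersions); Milne's extension theorem
(`AbelianVariety.existsUnique_extension_abelianVariety`, *Abelian Varieties* Thm. 3.1) extends it to
`f : E_Λ → E_Λ`; `g := f · f(O)⁻¹` fixes the origin, hence is a homomorphism (rigidity,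
`isMonHom_of_one_comp`, Milne Cor. 2.2). On an affine point `(x, y) = (℘ z, ℘'z/2)` with `Q(x) ≠ 0`, `f`
is the chart formula `(P/Q(x), (P'Q − PQ')(x)·y/(wQ(x)²)) = (℘(wz), ℘'(wz)/2)` (the transformation
identities), so the homomorphisms `p ↦ p ≫ g` and the analytic `π(z) ↦ π(wz)`
(`PeriodPair.exists_addMonoidHom_toPoint_mul`) of the infinite group `E_Λ(ℂ)` differ by the constant
`f(O)⁻¹` off a finite set, hence agree everywhere (`monoidHom_eq_one_of_eq_const_off_finite`).

## References
* D. A. Cox, *Primes of the form x² + ny²*, 2nd ed. (2013), Prop. 14.9. [Cox2013]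
* J. S. Milne, *Abelian Varieties* (1986), §2 Cor. 2.2, §3 Thm. 3.1. [Milne1986AbelianVarieties]
-/

noncomputable section

set_option linter.dupNamespace false

open CategoryTheory AlgebraicGeometry Polynomial MonoidalCategory CartesianMonoidalCategory
open scoped Polynomial.Bivariate MonObj
open Literature.AlgebraicGeometry Literature.AlgebraicGeometry.Motives
open WeierstrassCurve.Affine (CoordinateRing.mk)

namespace Summit.HodgeConjecture.HodgeConjecture.Theorems.WeilTwelvefoldsSqrtMinus7.AmnesicSecantSheaves

/-- **A homomorphism of an infinite abelian group which is constant off a finite set is trivial.**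
If `h : G → H` is a group homomorphism, `G` infinite, and `h(p) = c` for all `p` outside a finite
set `S`, then `h = 1` (pick `p₀, p₁ ∉ S` with `p₀p₁ ∉ S`: `c = c²`; then every `p` is `(pq)q⁻¹` with
`q, pq ∉ S`). [folklore] -/
theorem monoidHom_eq_one_of_eq_const_off_finite {G H : Type*} [CommGroup G] [Infinite G] [Group H]
    (h : G →* H) {S : Set G} (hS : S.Finite) (c : H) (hc : ∀ p ∉ S, h p = c) : h = 1 := by
  have key : ∀ p : G, ∃ q : G, q ∉ S ∧ p * q ∉ S := fun p => by
    have hfin : (S ∪ (fun q => p * q) ⁻¹' S).Finite :=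
      hS.union (hS.preimage (Set.injOn_of_injective (mul_right_injective p)))
    obtain ⟨q, hq⟩ := hfin.infinite_compl.nonempty
    exact ⟨q, fun h1 => hq (Or.inl h1), fun h2 => hq (Or.inr h2)⟩
  obtain ⟨p₀, hp₀⟩ := hS.infinite_compl.nonempty
  obtain ⟨p₁, hp₁, hp₀₁⟩ := key p₀
  have hc1 : c = 1 := by
    have e : h (p₀ * p₁) = h p₀ * h p₁ := map_mul h p₀ p₁
    rw [hc _ hp₀₁, hc _ hp₀, hc _ hp₁] at e
    have e' : c * c = c * 1 := by rw [mul_one]; exact e.symm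
    exact mul_left_cancel e'
  ext p
  obtain ⟨q, hq, hpq⟩ := key p
  have e : h p = h (p * q) * (h q)⁻¹ := by rw [map_mul, mul_inv_cancel_right]
  rw [e, hc _ hpq, hc _ hq, hc1, MonoidHom.one_apply, one_mul, inv_one]

/-- **Complex multiplication as an endomorphism of the abelian variety `E_Λ`.** For a period pair `L`,
`w ≠ 0`, and `P, Q ∈ ℂ[X]` with `Q ≠ 0`, `deg Q < deg P` satisfying the transformation identities `(H1)`,
`(H2)` for `(g₂(Λ), g₃(Λ))` with multiplier `w`, there is an endomorphism `φ` of the `ℂ`-group scheme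
`E_Λ` (the abelian variety `WeierstrassCurve.abelianVarietyOfAddHom` of `L.curve`) whose action on complex
points is `π(z) ↦ π(wz)`, `π = PeriodPair.upoint : ℂ → E_Λ(ℂ)` (Cox, Prop. 14.9 "`α(x, y) = (R(x), α⁻¹R′(x)y)`
defines `α ∈ End_ℂ(E)`"; made a morphism of schemes by Milne's extension theorem and rigidity). Def-free.
[cite: Cox2013, Prop. 14.9 (PDF pp. 318–319)] [cite: Milne1986AbelianVarieties, §3 Thm. 3.1] -/
theorem exists_endomorphism_of_transformation (L : PeriodPair) {w : ℂ} (hw : w ≠ 0) {P Q : ℂ[X]} (hQ : Q ≠ 0)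
    (hdeg : Q.natDegree < P.natDegree)
    (h1 : (C 4 * X ^ 3 - C L.g₂ * X - C L.g₃) * (derivative P * Q - P * derivative Q) ^ 2 =
      C (w ^ 2) * ((C 4 * P ^ 3 - C L.g₂ * P * Q ^ 2 - C L.g₃ * Q ^ 3) * Q))
    (h2 : C 2 * ((((derivative (derivative P)) * Q - P * derivative (derivative Q)) * Q -
        C 2 * (derivative Q * (derivative P * Q - P * derivative Q))) *
        (C 4 * X ^ 3 - C L.g₂ * X - C L.g₃)) +
      (derivative P * Q - P * derivative Q) * Q * (C 12 * X ^ 2 - C L.g₂) =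
      C (w ^ 2) * (C 12 * P ^ 2 * Q - C L.g₂ * Q ^ 3)) :
    ∃ φ : (L.curve.abelianVarietyOfAddHom L.curve.addHom L.curve.negHom L.curve.lift_pointEquiv_comp_addHom
          L.curve.pointEquiv_comp_negHom_geom) ⟶
        (L.curve.abelianVarietyOfAddHom L.curve.addHom L.curve.negHom L.curve.lift_pointEquiv_comp_addHom
          L.curve.pointEquiv_comp_negHom_geom),
      ∀ z : ℂ, L.upoint z ≫ φ.hom.hom.hom = L.upoint (w * z) := by
  -- the coordinate ring and the localisation at `Q(x)`
  let A : Type := L.curve.toAffine.CoordinateRing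
  let qA : A := CoordinateRing.mk L.curve.toAffine (C Q)
  let SL : Type := Localization.Away qA
  have hu : algebraMap A SL qA * IsLocalization.Away.invSelf qA = 1 := IsLocalization.Away.mul_invSelf qA
  obtain ⟨θ, hθC, hθx, hθy⟩ := exists_ringHom_of_transformation L hw h1 SL (algebraMap A SL)
    (IsLocalization.Away.invSelf qA) hu
  -- the abelian variety and the open immersion `Spec SL → Spec A → E`
  let E : AbelianVariety ℂ := L.curve.abelianVarietyOfAddHom L.curve.addHom L.curve.negHom
    L.curve.lift_pointEquiv_comp_addHom L.curve.pointEquiv_comp_negHom_geom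
  have hEX : E.X = L.curve.scheme := rfl
  let jS : Spec (CommRingCat.of SL) ⟶ Spec (CommRingCat.of A) :=
    Spec.map (CommRingCat.ofHom (algebraMap A SL))
  haveI : IsOpenImmersion jS := inferInstance
  let jj : Spec (CommRingCat.of SL) ⟶ L.curve.scheme.left := jS ≫ L.curve.chartHom
  haveI hjj : IsOpenImmersion jj := inferInstanceAs (IsOpenImmersion (jS ≫ L.curve.chartHom))
  let U : L.curve.scheme.left.Opens := jj.opensRange
  let g : (U : Scheme) ⟶ L.curve.scheme.left :=
    jj.isoOpensRange.inv ≫ Spec.map (CommRingCat.ofHom θ) ≫ L.curve.chartHom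
  have hstr : L.curve.chartHom ≫ L.curve.scheme.hom = Spec.map (CommRingCat.ofHom (algebraMap ℂ A)) :=
    L.curve.affineChart_over
  have hg : g ≫ L.curve.scheme.hom = U.ι ≫ L.curve.scheme.hom := by
    have e1 : U.ι = jj.isoOpensRange.inv ≫ jj := (jj.isoOpensRange_inv_comp).symm
    rw [e1]
    change (jj.isoOpensRange.inv ≫ Spec.map (CommRingCat.ofHom θ) ≫ L.curve.chartHom) ≫ L.curve.scheme.hom =
      (jj.isoOpensRange.inv ≫ jS ≫ L.curve.chartHom) ≫ L.curve.scheme.hom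
    simp only [Category.assoc]
    rw [hstr, ← Spec.map_comp, ← Spec.map_comp, ← CommRingCat.ofHom_comp, ← CommRingCat.ofHom_comp, hθC]
  have hqA : qA ≠ 0 := by
    intro h0
    have h1' : Q • (1 : A) + (0 : ℂ[X]) • CoordinateRing.mk L.curve.toAffine Polynomial.X = 0 := by
      rw [zero_smul, add_zero, WeierstrassCurve.Affine.CoordinateRing.smul, mul_one]
      exact h0
    exact hQ (WeierstrassCurve.Affine.CoordinateRing.smul_basis_eq_zero h1').1
  haveI : IsDomain SL :=
    IsLocalization.isDomain_localization (powers_le_nonZeroDivisors_of_noZeroDivisors hqA)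
  have hUne : (U : Set L.curve.scheme.left).Nonempty := by
    change (Set.range _).Nonempty
    exact Set.range_nonempty _
  obtain ⟨f, hf, -⟩ := AbelianVariety.existsUnique_extension_abelianVariety (A := E) E U hUne g hg
  set fl : L.curve.scheme.left ⟶ L.curve.scheme.left := f.left with hfl
  have hf' : (U.ι ≫ fl : (U : Scheme) ⟶ L.curve.scheme.left) = g := hf
  -- ### the chart formula: on affine points with `Q(x) ≠ 0`, `f` is `(x, y) ↦ (P/Q, D·y/(wQ²))`
  set D : ℂ[X] := derivative P * Q - P * derivative Q with hD
  have hjj : jS ≫ L.curve.chartHom = jj.isoOpensRange.hom ≫ U.ι := (jj.isoOpensRange_hom_ι).symm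
  have chart : ∀ (x y : ℂ) (h : L.curve.toAffine.Nonsingular x y), Q.eval x ≠ 0 →
      ∃ h' : L.curve.toAffine.Nonsingular (P.eval x * (Q.eval x)⁻¹)
        (D.eval x * y * (Q.eval x)⁻¹ ^ 2 * w⁻¹),
      L.curve.pointEquiv (WeierstrassCurve.Affine.Point.some x y h : L.curve.toAffine.Point) ≫ f =
        L.curve.pointEquiv (WeierstrassCurve.Affine.Point.some _ _ h' : L.curve.toAffine.Point) := by
    intro x y h hQx
    -- evaluation at `(x, y)` and its factorisation through `A[1/Q]`
    let ev : A →ₐ[ℂ] ℂ := L.curve.affineEval x y h.1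
    have hev : ∀ p : ℂ[X], ev (CoordinateRing.mk L.curve.toAffine (C p)) = p.eval x := fun p => by
      change (AdjoinRoot.liftAlgHom _ _ _ _) (AdjoinRoot.mk _ (C p)) = _
      rw [AdjoinRoot.coe_liftAlgHom, AdjoinRoot.lift_mk, eval₂_C, AlgHom.toRingHom_eq_coe,
        AlgHom.coe_toRingHom, Polynomial.coe_aeval_eq_eval]
    have hevy : ev (CoordinateRing.mk L.curve.toAffine Polynomial.X) = y := L.curve.affineEval_yClass x y h.1
    have hunit : IsUnit (ev.toRingHom qA) := by
      rw [AlgHom.toRingHom_eq_coe, AlgHom.coe_toRingHom, hev]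
      exact (IsUnit.mk0 _ hQx)
    let evS : SL →+* ℂ := IsLocalization.Away.lift qA hunit
    have hevS : ∀ a : A, evS (algebraMap A SL a) = ev a := fun a => IsLocalization.Away.lift_eq qA hunit a
    have hevSu : evS (IsLocalization.Away.invSelf qA) = (Q.eval x)⁻¹ := by
      have e := congrArg evS hu
      rw [map_mul, map_one, hevS] at e
      change ev (CoordinateRing.mk L.curve.toAffine (C Q)) * _ = 1 at e
      rw [hev] at e
      exact (eq_inv_of_mul_eq_one_right e)
    -- the composite `evS ∘ θ` is the evaluation at `(x', y')`
    have hcompC : ∀ c : ℂ, evS (θ (algebraMap ℂ A c)) = c := fun c => by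
      have e := congrArg (fun φ : ℂ →+* SL => evS (φ c)) hθC
      simp only [RingHom.comp_apply] at e
      rw [e, hevS, AlgHom.commutes]
      rfl
    let ψ : A →ₐ[ℂ] ℂ :=
      { toRingHom := evS.comp θ
        commutes' := fun c => by
          rw [RingHom.toFun_eq_coe, RingHom.comp_apply]
          exact hcompC c }
    have hψx : ψ (WeierstrassCurve.xClass L.curve) = P.eval x * (Q.eval x)⁻¹ := by
      change evS (θ (CoordinateRing.mk L.curve.toAffine (C X))) = _
      rw [hθx, map_mul, hevS, hevSu]
      rw [hev]
    have hψy : ψ (WeierstrassCurve.yClass L.curve) = D.eval x * y * (Q.eval x)⁻¹ ^ 2 * w⁻¹ := by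
      change evS (θ (CoordinateRing.mk L.curve.toAffine Polynomial.X)) = _
      rw [hθy, map_mul, map_mul, map_mul, map_pow, hevS, hevS, hevSu, hevS]
      rw [hev, hevy, AlgHom.commutes]
      rfl
    have hEq' := L.curve.equation_algHom ψ
    rw [hψx, hψy] at hEq'
    have h' : L.curve.toAffine.Nonsingular (P.eval x * (Q.eval x)⁻¹)
        (D.eval x * y * (Q.eval x)⁻¹ ^ 2 * w⁻¹) :=
      (WeierstrassCurve.Affine.equation_iff_nonsingular.mp hEq')
    refine ⟨h', ?_⟩
    have hψev : ψ = L.curve.affineEval _ _ h'.1 :=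
      L.curve.affine_algHom_ext (by rw [hψx, WeierstrassCurve.affineEval_xClass])
        (by rw [hψy, WeierstrassCurve.affineEval_yClass])
    -- compare the underlying morphisms of schemes
    have hPt : L.curve.pointEquiv (WeierstrassCurve.Affine.Point.some x y h : L.curve.toAffine.Point) =
        L.curve.chartPoint (X := L.curve.scheme) L.curve.affineChart.left L.curve.affineChart_over x y h.1 := by
      change L.curve.pointEquiv (WeierstrassCurve.Affine.Point.some x y h) = _
      rw [WeierstrassCurve.pointEquiv_some]; exact (L.curve.chartPoint_affineChart x y h.1).symm
    have hPt' : L.curve.pointEquiv (WeierstrassCurve.Affine.Point.some _ _ h' : L.curve.toAffine.Point) =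
        L.curve.chartPoint (X := L.curve.scheme) L.curve.affineChart.left L.curve.affineChart_over _ _ h'.1 := by
      change L.curve.pointEquiv (WeierstrassCurve.Affine.Point.some _ _ h') = _
      rw [WeierstrassCurve.pointEquiv_some]; exact (L.curve.chartPoint_affineChart _ _ h'.1).symm
    rw [hPt, hPt']
    refine Over.OverMorphism.ext ?_
    rw [Over.comp_left, WeierstrassCurve.chartPoint_left, WeierstrassCurve.chartPoint_left, ← hψev]
    have hfac : Spec.map (CommRingCat.ofHom ev.toRingHom) = Spec.map (CommRingCat.ofHom evS) ≫ jS := by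
      rw [← Spec.map_comp, ← CommRingCat.ofHom_comp, IsLocalization.Away.lift_comp]
    change (Spec.map (CommRingCat.ofHom ev.toRingHom) ≫ L.curve.chartHom) ≫ fl =
      Spec.map (CommRingCat.ofHom (evS.comp θ)) ≫ L.curve.chartHom
    rw [hfac]
    simp only [Category.assoc]
    rw [reassoc_of% hjj, hf']
    change Spec.map (CommRingCat.ofHom evS) ≫ jj.isoOpensRange.hom ≫ jj.isoOpensRange.inv ≫
      Spec.map (CommRingCat.ofHom θ) ≫ L.curve.chartHom = _
    rw [Iso.hom_inv_id_assoc, ← Spec.map_comp_assoc, ← CommRingCat.ofHom_comp]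
  -- ### (L2) on the uniformisation: `π(z) ≫ f = π(wz)` for `z ∉ Λ`, `Q(℘ z) ≠ 0`
  have some_eq : ∀ {x y x' y' : ℂ} (hx : x = x') (hy : y = y')
      (hh : L.curve.toAffine.Nonsingular x y) (hh' : L.curve.toAffine.Nonsingular x' y'),
      (WeierstrassCurve.Affine.Point.some x y hh : L.curve.toAffine.Point) =
        WeierstrassCurve.Affine.Point.some x' y' hh' := by
    intro x y x' y' hx hy hh hh'; subst hx; subst hy; rfl
  have anal : ∀ z : ℂ, z ∉ L.lattice → Q.eval (L.weierstrassP z) ≠ 0 → L.upoint z ≫ f = L.upoint (w * z) := by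
    intro z hz hQz
    have hwz : w * z ∉ L.lattice := L.mul_notMem_lattice_of_eval_ne_zero hw hQ hdeg h1 h2 hz hQz
    have hP : P.eval (L.weierstrassP z) = L.weierstrassP (w * z) * Q.eval (L.weierstrassP z) :=
      L.eval_weierstrassP_eq_weierstrassP_mul_mul hw hQ hdeg h1 h2 hz hwz
    have hP' : w * L.derivWeierstrassP (w * z) * Q.eval (L.weierstrassP z) ^ 2 = D.eval (L.weierstrassP z) * L.derivWeierstrassP z :=
      L.derivWeierstrassP_mul_of_transformation hw hQ hdeg h1 h2 hz hwz
    obtain ⟨h', hch⟩ := chart (L.weierstrassP z) (L.derivWeierstrassP z / 2) (PeriodPair.nonsingular_weierstrassP hz) hQz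
    rw [PeriodPair.upoint, PeriodPair.toPoint_of_notMem hz, hch, PeriodPair.upoint, PeriodPair.toPoint_of_notMem hwz]
    congr 1
    apply some_eq
    · rw [hP, mul_assoc, mul_inv_cancel₀ hQz, mul_one]
    · have hQ2 : Q.eval (L.weierstrassP z) ^ 2 ≠ 0 := pow_ne_zero 2 hQz
      have hA : L.derivWeierstrassP (w * z) =
          (w * Q.eval (L.weierstrassP z) ^ 2)⁻¹ * (D.eval (L.weierstrassP z) * L.derivWeierstrassP z) := by
        rw [eq_inv_mul_iff_mul_eq₀ (mul_ne_zero hw hQ2)]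
        linear_combination hP'
      rw [hA]
      ring
  -- ### (L5) origin correction, rigidity, and the endomorphism
  let κ : 𝟙_ (SchemeOver ℂ) ⟶ E.X := η[E.X] ≫ f
  let g₁ : E.X ⟶ E.X := f * (toUnit E.X ≫ κ)⁻¹
  have hηt : η[E.X] ≫ toUnit E.X = 𝟙 _ := Subsingleton.elim _ _
  have hg₁ : η[E.X] ≫ g₁ = η[E.X] := by
    change η[E.X] ≫ (f * (toUnit E.X ≫ κ)⁻¹) = η[E.X]
    rw [MonObj.comp_mul, GrpObj.comp_inv, ← Category.assoc, hηt, Category.id_comp, mul_inv_cancel,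
      ← MonObj.one_eq_one]
  haveI : IsMonHom g₁ := isMonHom_of_one_comp (A := E) (B := E) g₁ hg₁
  refine ⟨InducedCategory.homMk (Grp.homMk g₁), ?_⟩
  change ∀ z : ℂ, L.upoint z ≫ g₁ = L.upoint (w * z)
  -- the two homomorphisms of `E(ℂ)`: `p ↦ p ≫ g₁` and the analytic `π(z) ↦ π(wz)`
  letI instGrp : GrpObj L.curve.scheme := E.grpObj
  haveI instComm : IsCommMonObj L.curve.scheme := AbelianVariety.instIsCommMonObj E
  let g₁' : L.curve.scheme ⟶ L.curve.scheme := g₁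
  haveI : IsMonHom g₁' := ‹IsMonHom g₁›
  let f' : L.curve.scheme ⟶ L.curve.scheme := f
  let κ' : 𝟙_ (SchemeOver ℂ) ⟶ L.curve.scheme := κ
  have hg₁' : g₁' = f' * (toUnit L.curve.scheme ≫ κ')⁻¹ := rfl
  change ∀ z : ℂ, L.upoint z ≫ g₁' = L.upoint (w * z)
  let pe : L.curve.toAffine.Point ≃ AlgPoints L.curve.scheme ℂ := L.curve.pointEquiv (L := ℂ)
  have hupt : ∀ z : ℂ, L.upoint z = pe (L.toPoint z) := fun z => rfl
  haveI : Infinite L.curve.toAffine.Point := WeierstrassCurve.infinite_point (V := L.curve)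
  haveI : Infinite (AlgPoints L.curve.scheme ℂ) := Infinite.of_injective pe pe.injective
  let F : AlgPoints L.curve.scheme ℂ →* AlgPoints L.curve.scheme ℂ :=
    { toFun := fun p => p ≫ g₁'
      map_one' := MonObj.one_comp g₁'
      map_mul' := fun p q => MonObj.mul_comp p q g₁' }
  have hwΛ : ∀ l ∈ L.lattice, w * l ∈ L.lattice := fun l hl =>
    L.mul_mem_lattice_of_transformation hw hQ h1 h2 hl
  obtain ⟨Aw, hAw⟩ := L.exists_addMonoidHom_toPoint_mul hwΛ
  have hmul : ∀ a b : L.curve.toAffine.Point, pe (a + b) = pe a * pe b := by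
    intro a b
    change L.curve.pointEquiv (a + b) = lift (L.curve.pointEquiv a) (L.curve.pointEquiv b) ≫ L.curve.addHom
    exact (L.curve.lift_pointEquiv_comp_addHom_of_field (L := ℂ) a b).symm
  have h1pt : pe 0 = 1 := by
    have e := hmul 0 0
    rw [add_zero] at e
    have e' : pe 0 * pe 0 = pe 0 * 1 := by rw [mul_one]; exact e.symm
    exact mul_left_cancel e'
  have hsymm_mul : ∀ p q : AlgPoints L.curve.scheme ℂ, pe.symm (p * q) = pe.symm p + pe.symm q := by
    intro p q
    apply pe.injective
    rw [hmul, Equiv.apply_symm_apply, Equiv.apply_symm_apply, Equiv.apply_symm_apply]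
  have hsymm_one : pe.symm 1 = 0 := by
    apply pe.injective
    rw [Equiv.apply_symm_apply, h1pt]
  let αw : AlgPoints L.curve.scheme ℂ →* AlgPoints L.curve.scheme ℂ :=
    { toFun := fun p => pe (Aw (pe.symm p))
      map_one' := by
        change pe (Aw (pe.symm 1)) = 1
        rw [hsymm_one, map_zero, h1pt]
      map_mul' := fun p q => by
        rw [hsymm_mul, map_add, hmul] }
  have hαw : ∀ z : ℂ, αw (L.upoint z) = L.upoint (w * z) := fun z => by
    change pe (Aw (pe.symm (L.upoint z))) = _
    rw [hupt, hupt, Equiv.symm_apply_apply, hAw]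
  -- the exceptional finite set: `O` and the affine points with `Q(x) = 0`
  let T : Set L.curve.toAffine.Point :=
    {0} ∪ {pt | ∃ (x y : ℂ) (h : L.curve.toAffine.Nonsingular x y),
      pt = WeierstrassCurve.Affine.Point.some x y h ∧ Q.eval x = 0}
  have hT : T.Finite := by
    refine (Set.finite_singleton _).union ?_
    classical
    let R : Finset (ℂ × ℂ) := Q.roots.toFinset.biUnion fun x =>
      ((Polynomial.nthRoots 2 (x ^ 3 - L.g₂ / 4 * x - L.g₃ / 4)).toFinset).image fun y => (x, y)
    refine ((R : Set (ℂ × ℂ)).toFinite.biUnion (t := fun xy =>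
      {pt | ∃ h : L.curve.toAffine.Nonsingular xy.1 xy.2, pt = WeierstrassCurve.Affine.Point.some xy.1 xy.2 h})
      fun xy _ => ?_).subset ?_
    · refine Set.Subsingleton.finite ?_
      rintro _ ⟨h₁, rfl⟩ _ ⟨h₂, rfl⟩
      rfl
    · rintro pt ⟨x, y, h, rfl, hx⟩
      refine Set.mem_iUnion₂.mpr ⟨(x, y), ?_, h, rfl⟩
      have hy : y ^ 2 = x ^ 3 - L.g₂ / 4 * x - L.g₃ / 4 := (L.equation_curve_iff x y).mp h.1
      simp only [R, Finset.coe_biUnion, Finset.coe_image, Set.mem_iUnion, Set.mem_image, Finset.mem_coe,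
        Multiset.mem_toFinset, Polynomial.mem_roots hQ, Polynomial.IsRoot.def, Prod.mk.injEq]
      exact ⟨x, hx, y, (Polynomial.mem_nthRoots two_pos).mpr hy, rfl, rfl⟩
  let S : Set (AlgPoints L.curve.scheme ℂ) := pe '' T
  have hS : S.Finite := hT.image _
  -- off `S`, `F / αw` is the constant `c⁻¹`, `c = f(O)`
  let c : AlgPoints L.curve.scheme ℂ := toUnit (specOver ℂ ℂ) ≫ κ'
  have hFα : ∀ p : AlgPoints L.curve.scheme ℂ, p ∉ S → (F / αw) p = c⁻¹ := by
    intro p hp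
    obtain ⟨z, rfl⟩ := L.upoint_surjective p
    have hz : z ∉ L.lattice := fun hz => hp ⟨0, Or.inl rfl, by rw [hupt, PeriodPair.toPoint_of_mem hz]⟩
    have hQz : Q.eval (L.weierstrassP z) ≠ 0 := fun hQz =>
      hp ⟨_, Or.inr ⟨_, _, PeriodPair.nonsingular_weierstrassP hz, rfl, hQz⟩, by
        rw [hupt, PeriodPair.toPoint_of_notMem hz]⟩
    rw [MonoidHom.div_apply, hαw]
    change (L.upoint z ≫ g₁') / L.upoint (w * z) = c⁻¹
    rw [hg₁', MonObj.comp_mul, GrpObj.comp_inv, ← Category.assoc, comp_toUnit]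
    have hanal : L.upoint z ≫ f' = L.upoint (w * z) := anal z hz hQz
    rw [hanal]
    change L.upoint (w * z) * c⁻¹ / L.upoint (w * z) = c⁻¹
    rw [mul_comm, mul_div_assoc, div_self', mul_one]
  have hF : F / αw = 1 := monoidHom_eq_one_of_eq_const_off_finite (F / αw) hS c⁻¹ hFα
  intro z
  have e := congrArg (fun m : AlgPoints L.curve.scheme ℂ →* AlgPoints L.curve.scheme ℂ => m (L.upoint z)) hF
  simp only [MonoidHom.div_apply, MonoidHom.one_apply, div_eq_one] at e
  rw [← hαw z, ← e]
  rfl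

end Summit.HodgeConjecture.HodgeConjecture.Theorems.WeilTwelvefoldsSqrtMinus7.AmnesicSecantSheaves

end
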